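import Summits.Langlands.Langlands.Theses.DyadicOddResidue
import Literature.NumberTheory.GaloisRepresentations.OrdinaryGaloisRep

/-!
# Sketch — first lemmas for the crux ideas on `DyadicDihedralFM` (stmt-Langlands-18742)

Crux-ideate round 1, ideator 1.  Three cells of the crux and the first checkable statement of
each idea card, typed over existing declarations.  Nothing here is proved except the cover lemma
`cells_cover` (pure logic) and the characteristic-2 centralizer count is only *stated*.
-/

namespace Summit.Langlands.Langlands.Cruxes.DyadicDihedralFM.Ideas

open scoped BigOperators Topology Classical
open Filter Set Function
open Literature.NumberTheory.GaloisRepresentations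
open Summit.Langlands.Langlands.Theses.DyadicOddResidue

/-- Common hypothesis block of the crux, as a predicate on `(ℓ, ρ)` (verbatim binders of
`DyadicOddResidue.DyadicDihedralFM`). -/
def CruxHyp (ℓ : ℕ) [Fact ℓ.Prime]
    (ρ : FramedGaloisRep ℚ (PadicAlgCl ℓ) 2) : Prop :=
  ρ.IsResiduallyAbsIrreducible ∧ IsSolvable ρ.residualRep.range ∧ ρ.toGaloisRep.IsIrreducible ∧
    ρ.IsOdd ∧
    (∀ᶠ v : IsDedekindDomain.HeightOneSpectrum (NumberField.RingOfIntegers ℚ) in Filter.cofinite,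
      ρ.IsUnramifiedAt v) ∧
    (∀ (v : IsDedekindDomain.HeightOneSpectrum (NumberField.RingOfIntegers ℚ))
      (hv : ((ℓ : ℕ) : NumberField.RingOfIntegers ℚ) ∈ v.asIdeal),
      (Literature.NumberTheory.PAdicHodge.fontainePstAdicCompletion v ℓ hv).IsDeRhamFramed
          (ρ.toLocal v) ∧
        ∀ τ : v.adicCompletion ℚ →+* PadicAlgCl ℓ, Continuous τ →
          (ρ.labelledHodgeTateWeightsAt v
            (Literature.NumberTheory.PAdicHodge.fontainePstAdicCompletion v ℓ hv).algebra
            (Literature.NumberTheory.PAdicHodge.fontainePstAdicCompletion v ℓ hv).𝔅 τ).Nodup)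

/-- Common conclusion block of the crux. -/
def CruxConcl (ℓ : ℕ) [Fact ℓ.Prime]
    (ρ : FramedGaloisRep ℚ (PadicAlgCl ℓ) 2) : Prop :=
  ∀ (hcpt : Literature.NumberTheory.Automorphic.isCompact_glFiniteIntegralLevel 2 ℚ)
    (ι : PadicAlgCl ℓ ≃+* ℂ),
    ∃ π : Literature.NumberTheory.Automorphic.CuspidalAutomorphicRepData 2 ℚ hcpt,
      π.1.IsLAlgebraic ∧
        ∀ᶠ v : IsDedekindDomain.HeightOneSpectrum (NumberField.RingOfIntegers ℚ) in Filter.cofinite,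
          Summit.Langlands.SatakeFrobCompatibleAt ι π.1 ρ v

/-- CONSECUTIVE-WEIGHT predicate: at the place above `ℓ` every labelled Hodge–Tate multiset is
`{a, a+1}` for some `a` (potentially Barsotti–Tate up to a Tate twist; any slope). -/
def HasConsecutiveWeights (ℓ : ℕ) [Fact ℓ.Prime]
    (ρ : FramedGaloisRep ℚ (PadicAlgCl ℓ) 2) : Prop :=
  ∀ (v : IsDedekindDomain.HeightOneSpectrum (NumberField.RingOfIntegers ℚ))
    (hv : ((ℓ : ℕ) : NumberField.RingOfIntegers ℚ) ∈ v.asIdeal)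
    (τ : v.adicCompletion ℚ →+* PadicAlgCl ℓ), Continuous τ →
      ∃ a : ℤ, ρ.labelledHodgeTateWeightsAt v
          (Literature.NumberTheory.PAdicHodge.fontainePstAdicCompletion v ℓ hv).algebra
          (Literature.NumberTheory.PAdicHodge.fontainePstAdicCompletion v ℓ hv).𝔅 τ = {a, a + 1}

/-- ORDINARY predicate: at the place above `ℓ`, `ρ` is ordinary of some weight `k ≥ 2` with some
inertial exponent (Skinner–Wiles shape `(ψ₁ χ^{k-1} ∗ ; 0 ψ₂)`, tree's `IsOrdinaryOfWeightAt`). -/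
def IsOrdinaryAtTwo (ℓ : ℕ) [Fact ℓ.Prime]
    (ρ : FramedGaloisRep ℚ (PadicAlgCl ℓ) 2) : Prop :=
  ∀ (v : IsDedekindDomain.HeightOneSpectrum (NumberField.RingOfIntegers ℚ)),
    ((ℓ : ℕ) : NumberField.RingOfIntegers ℚ) ∈ v.asIdeal →
      ∃ k m : ℕ, 2 ≤ k ∧ 1 ≤ m ∧ FramedGaloisRep.IsOrdinaryOfWeightAt ℓ ρ v k m

/-- CARD `deep-congruence-supersingular` — FIRST LEMMA (the cell it closes): the crux on the
consecutive-weight cell, ANY slope at `2` (Thorne 2026 Thm D is its ordinary half). -/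
def ConsecutiveWeightCell : Prop :=
  ∀ (ℓ : ℕ) [Fact ℓ.Prime], ℓ = 2 → ∀ (ρ : FramedGaloisRep ℚ (PadicAlgCl ℓ) 2),
    CruxHyp ℓ ρ → HasConsecutiveWeights ℓ ρ → CruxConcl ℓ ρ

/-- Thorne, arXiv:2608.07186 Thm D (7 Aug 2026), typed in the crux vocabulary (to be vendored as a
cite fact; here only the shape): `p = 2`, ordinary of weight `2` at `2`, no residual hypothesis. -/
def ThorneD_OrdinaryWeightTwo : Prop :=
  ∀ (ℓ : ℕ) [Fact ℓ.Prime], ℓ = 2 → ∀ (ρ : FramedGaloisRep ℚ (PadicAlgCl ℓ) 2),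
    ρ.toGaloisRep.IsIrreducible → ρ.IsOdd →
    (∀ᶠ v : IsDedekindDomain.HeightOneSpectrum (NumberField.RingOfIntegers ℚ) in Filter.cofinite,
      ρ.IsUnramifiedAt v) →
    (∀ (v : IsDedekindDomain.HeightOneSpectrum (NumberField.RingOfIntegers ℚ)),
      ((ℓ : ℕ) : NumberField.RingOfIntegers ℚ) ∈ v.asIdeal →
        ∃ m : ℕ, 1 ≤ m ∧ FramedGaloisRep.IsOrdinaryOfWeightAt ℓ ρ v 2 m) →
    CruxConcl ℓ ρ

/-- CARD `hida-ascent-from-weight-two` — FIRST LEMMA (the ascent): from the printed weight-2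
ordinary theorem to the whole ordinary cell of the crux (all weights, Allen's CM-split corner
included). -/
def OrdinaryCell : Prop :=
  ∀ (ℓ : ℕ) [Fact ℓ.Prime], ℓ = 2 → ∀ (ρ : FramedGaloisRep ℚ (PadicAlgCl ℓ) 2),
    CruxHyp ℓ ρ → IsOrdinaryAtTwo ℓ ρ → CruxConcl ℓ ρ

def HidaAscent : Prop := ThorneD_OrdinaryWeightTwo → OrdinaryCell

/-- CARD `cm-divisor-nice-primes` — the cell it is aimed at (everything else): non-ordinary and
not of consecutive weight. -/
def RemainderCell : Prop :=
  ∀ (ℓ : ℕ) [Fact ℓ.Prime], ℓ = 2 → ∀ (ρ : FramedGaloisRep ℚ (PadicAlgCl ℓ) 2),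
    CruxHyp ℓ ρ → ¬ HasConsecutiveWeights ℓ ρ → ¬ IsOrdinaryAtTwo ℓ ρ → CruxConcl ℓ ρ

/-- CARD `cm-divisor-nice-primes` — FIRST LEMMA (the Euler-characteristic input that separates
`L` imaginary from `L` real): in characteristic `2`, a non-trivial involution of `k²` has a
centraliser of dimension exactly `2` in `M₂(k)` (so `h⁰(G_ℝ, ad ρ̄) = 2` iff `ρ̄(c) ≠ 1`). -/
def CentralizerOfInvolutionCharTwo : Prop :=
  ∀ (k : Type) [Field k] [CharP k 2] (u : Matrix (Fin 2) (Fin 2) k), u * u = 1 → u ≠ 1 →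
    Module.finrank k
        (LinearMap.ker ((LinearMap.mulLeft k u).comp (LinearMap.mulRight k u) - LinearMap.id)) = 2

/-- The three cells cover the crux (pure logic). -/
theorem cells_cover (hA : ConsecutiveWeightCell) (hC : OrdinaryCell) (hB : RemainderCell) :
    DyadicDihedralFM := by
  intro ℓ _ hℓ ρ hres hsol hirr hodd hunr hdR hcpt ι
  have hyp : CruxHyp ℓ ρ := ⟨hres, hsol, hirr, hodd, hunr, hdR⟩
  by_cases h1 : HasConsecutiveWeights ℓ ρ
  · exact hA ℓ hℓ ρ hyp h1 hcpt ι
  · by_cases h2 : IsOrdinaryAtTwo ℓ ρ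
    · exact hC ℓ hℓ ρ hyp h2 hcpt ι
    · exact hB ℓ hℓ ρ hyp h1 h2 hcpt ι

/-- Conversely each cell is implied by the crux (they are honest sub-statements). -/
theorem consecutiveWeightCell_of (h : DyadicDihedralFM) : ConsecutiveWeightCell := by
  intro ℓ _ hℓ ρ hyp _ hcpt ι
  obtain ⟨hres, hsol, hirr, hodd, hunr, hdR⟩ := hyp
  exact h ℓ hℓ ρ hres hsol hirr hodd hunr hdR hcpt ι

end Summit.Langlands.Langlands.Cruxes.DyadicDihedralFM.Ideas
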